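import Summits.QuantumFields.YangMills.Theses.ForcedResponseSkewness
import Summits.QuantumFields.YangMills.Theorems.ForcedResponseSkewnessAssemblyRel
import Summits.QuantumFields.YangMills.Theorems.ForcedResponseSkewnessAssemblyGlue
import Summits.QuantumFields.YangMills.Theorems.ForcedResponseSkewnessAssemblyGlueSigned
import HarnessLib

/-!
# Route `ForcedResponseSkewness`, item `Assembly` (stmt-QuantumFields-23618):
# `FloorWithScalingLimits → RunningCouplingCeiling → ResponseLocalisation → BalabanLadder.NT`

The MVT / first-crossing / transport argument of the route card, over the tree's exact coupling
differentiability of clause (i)'s object (`SkewResponse.differentiable_Q2_coupling`).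

Order of choices (route rev 3 — the cruxes repaired with compact, shrinking, L¹-normalised supports and a
RELATIVE localisation tolerance; for a compact simple `G`, Borel σ-algebra): `(r, a, κ, p, ε)` and the
support-shrinking family `v_ρ` from the residual `FloorWithScalingLimits`; `C` from `RunningCouplingCeiling`
(uniform over normalised sources in `closedBall p (p₀/2)`, the unit being pinned by the compactly supported
member `v_{p₀/2}`); a window `Λ ≥ 2` with `C / log² Λ ≤ ε/4` and a coupling range `T₀ ≥ 1` with
`e^{κ T₀} = 3Λ/2 ∈ (Λ, 2Λ)` (`exists_window`); the radius `ρ` of `ResponseLocalisation` at tolerance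
`η = min(1/2, ε/(8T₀))` on the window `[1, 2Λ]`; THE test function `v := v_{min ρ (p₀/2)}`, its source `f` and its
limits `Φ₂`, `Φ₃ = Φ₃^f`; the thresholds of the four `∃ β₆ Λ₆` clauses and of the ratio law
`a(c)/a(c+T₀) ∈ [Λ, 2Λ]`; one coupling `c₀` above all of them and ONE torus `L₀` with `a(c₀+T₀)·L₀` above every
`Λ₆`.  Then
`q(c) := Q2_{c,L₀,a(c₀)}(θv,v)` is differentiable, `q(c₀) ≥ ε` (floor) and `q(c₀+T₀) ≤ ε/4` (ceiling at
`l = a(c₀)/a(c₀+T₀) ∈ [Λ, 2Λ]`), so the first crossing of the level `ε/2` and the mean-value theorem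
(`exists_level_and_negative_slope`) give `c* ∈ (c₀, c₀+T₀)` with `q(c*) > ε/2`, `q'(c*) ≤ −ε/(2T₀)`;
with `λ* := a(c₀)/a(c*) ∈ [1, 2Λ]` relative localisation (`η ≤ 1/2`, `η ≤ ε/(8T₀)`, `q' < 0`) gives
`Q3_{c*,L₀,a(c₀)}(f,θv,v) ≤ (1−η)q' + η ≤ −ε/(8T₀)`, the two limit clauses at `l = λ*` give
`Φ₂(λ*) ≥ ε/2 − ε/(32T₀)`, `Φ₃(λ*) ≤ −ε/(8T₀) + ε/(32T₀)`, and transport to every large `β` and torus yields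
`Q2 ≥ ε/4`, `Q3 ≤ −ε/(16T₀)` at spacing `λ*·a(β)`: `LowerBounds G r (λ*·a)`,
i.e. `NT` with the unit `a' := λ*·a` (`lowerBounds_of_floor_ceiling_localisation_rel` in `…AssemblyRel`, `assembly_proof`).
The rev-0 transport lemma `lowerBounds_of_floor_ceiling_localisation` (absolute tolerance, window chosen inside) is kept below
append-only; no rev-3 crux supplies its hypotheses any more.

This file proves the route's ASSEMBLY only.  It does NOT prove `NT`, nor the Yang–Mills mass gap: the three
hypotheses (the declared residual `FloorWithScalingLimits`, which contains NT's clause (i), and the two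
ceilings) remain open items of the route.

Refs: route file `Theses/ForcedResponseSkewness.lean` (§Assembly); Rothe 2005 p.138 (action sum rule);
`Theorems/BalabanLadderNTSkewResponseCoupling.lean`.
-/

set_option autoImplicit false

noncomputable section

open scoped SchwartzMap
open MeasureTheory Filter Topology
open Literature.MathematicalPhysics.QuantumFieldTheory Literature.MathematicalPhysics.QuantumLattice
open Summit.QuantumFields.YangMills.Cruxes.OSLegsFromFemtoAndGap.DlrCollarTransfer

namespace Summit.QuantumFields.YangMills.Theorems.ForcedResponseSkewness

/-! ## §1 Real analysis: a drop forces a slope; the window -/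

/-- **A drop forces a slope** (first crossing time + mean-value theorem).  If `q` is differentiable,
`q c₀ ≥ ε` and `q (c₀ + T) ≤ ε/4` with `T > 0`, `ε > 0`, then some `c ∈ (c₀, c₀+T)` has `q c > ε/2` and
`deriv q c ≤ −ε/(2T)`.  (Adapted from the planner's BC5 rung `Assembly_rung_crossing.lean`.) [folklore] -/
theorem exists_level_and_negative_slope (q : ℝ → ℝ) (hq : Differentiable ℝ q) {c₀ T ε : ℝ}
    (hT : 0 < T) (hε : 0 < ε) (h0 : ε ≤ q c₀) (h1 : q (c₀ + T) ≤ ε / 4) :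
    ∃ c ∈ Set.Ioo c₀ (c₀ + T), ε / 2 < q c ∧ deriv q c ≤ -(ε / (2 * T)) := by
  have hqc : Continuous q := hq.continuous
  -- the set of crossing times of the level ε/2
  set S : Set ℝ := {c | c ∈ Set.Icc c₀ (c₀ + T) ∧ q c ≤ ε / 2} with hS
  have hne : S.Nonempty := ⟨c₀ + T, ⟨⟨by linarith, le_rfl⟩, by linarith⟩⟩
  have hbdd : BddBelow S := ⟨c₀, fun c hc => hc.1.1⟩
  have hclosed : IsClosed S := by
    have : S = Set.Icc c₀ (c₀ + T) ∩ q ⁻¹' Set.Iic (ε / 2) := by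
      ext c; simp [hS, Set.mem_Iic]
    rw [this]
    exact isClosed_Icc.inter (isClosed_Iic.preimage hqc)
  set t₂ := sInf S with ht₂
  have ht₂S : t₂ ∈ S := hclosed.csInf_mem hne hbdd
  have ht₂le : t₂ ≤ c₀ + T := ht₂S.1.2
  have hqt₂ : q t₂ ≤ ε / 2 := ht₂S.2
  -- before t₂ the function stays above ε/2
  have habove : ∀ c, c₀ ≤ c → c < t₂ → ε / 2 < q c := by
    intro c hc hct
    by_contra hcon
    have hcS : c ∈ S := ⟨⟨hc, by linarith⟩, not_lt.1 hcon⟩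
    have : t₂ ≤ c := csInf_le hbdd hcS
    linarith
  have ht₂gt : c₀ < t₂ := by
    rcases lt_or_ge c₀ t₂ with h | h
    · exact h
    · exfalso
      have : t₂ = c₀ := le_antisymm h ht₂S.1.1
      rw [this] at hqt₂
      linarith
  -- mean value theorem on [c₀, t₂]
  obtain ⟨c, hc, hderiv⟩ := exists_deriv_eq_slope q ht₂gt hqc.continuousOn
    (hq.differentiableOn.mono Set.Ioo_subset_Icc_self)
  refine ⟨c, ⟨hc.1, lt_of_lt_of_le hc.2 ht₂le⟩, habove c hc.1.le hc.2, ?_⟩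
  rw [hderiv]
  have hpos : 0 < t₂ - c₀ := by linarith
  rw [div_le_iff₀ hpos]
  have hnum : q t₂ - q c₀ ≤ -(ε / 2) := by linarith
  have hTle : t₂ - c₀ ≤ T := by linarith
  calc q t₂ - q c₀ ≤ -(ε / 2) := hnum
    _ = -(ε / (2 * T)) * T := by field_simp
    _ ≤ -(ε / (2 * T)) * (t₂ - c₀) := by
        have hneg : -(ε / (2 * T)) ≤ 0 := by
          have : 0 < ε / (2 * T) := by positivity
          linarith
        exact mul_le_mul_of_nonpos_left hTle hneg

/-- **The window.**  For `ε, κ > 0` and any `C` there are a scale window `Λ ≥ 2` at which the ceiling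
constant is below a quarter of the floor, `C / log² Λ ≤ ε/4`, and a coupling range `T₀ ≥ 1` whose
asymptotic-scaling ratio `e^{κ T₀} = 3Λ/2` sits strictly inside `(Λ, 2Λ)`. [folklore] -/
theorem exists_window (ε κ C : ℝ) (hε : 0 < ε) (hκ : 0 < κ) :
    ∃ Λ T₀ : ℝ, 2 ≤ Λ ∧ 1 ≤ T₀ ∧ Real.exp (κ * T₀) = 3 * Λ / 2 ∧ C / Real.log Λ ^ 2 ≤ ε / 4 := by
  set Cp : ℝ := max C 0 with hCp
  set M : ℝ := max 1 (4 * Cp / ε) with hM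
  set Λ : ℝ := max 2 (max (Real.exp κ) (Real.exp M)) with hΛ
  have hΛ2 : 2 ≤ Λ := le_max_left _ _
  have hΛκ : Real.exp κ ≤ Λ := le_trans (le_max_left _ _) (le_max_right _ _)
  have hΛM : Real.exp M ≤ Λ := le_trans (le_max_right _ _) (le_max_right _ _)
  have hΛpos : 0 < Λ := by linarith
  have hM1 : 1 ≤ M := le_max_left _ _
  have hlogΛ : M ≤ Real.log Λ := by
    rw [← Real.log_exp M]
    exact Real.log_le_log (Real.exp_pos M) hΛM
  have hlogpos : 0 < Real.log Λ := by linarith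
  have h32pos : 0 < 3 * Λ / 2 := by positivity
  refine ⟨Λ, Real.log (3 * Λ / 2) / κ, hΛ2, ?_, ?_, ?_⟩
  · -- `T₀ ≥ 1`: `κ = log e^κ ≤ log Λ ≤ log (3Λ/2)`
    rw [le_div_iff₀ hκ, one_mul, ← Real.log_exp κ]
    exact Real.log_le_log (Real.exp_pos κ) (by linarith)
  · rw [mul_div_cancel₀ _ hκ.ne', Real.exp_log h32pos]
  · rw [div_le_iff₀ (by positivity : (0 : ℝ) < Real.log Λ ^ 2)]
    have h1 : C ≤ Cp := le_max_left _ _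
    have h0 : 0 ≤ Cp := le_max_right _ _
    have h2 : 4 * Cp / ε ≤ M := le_max_right _ _
    have h3 : 4 * Cp ≤ M * ε := (div_le_iff₀ hε).1 h2
    have hsq : Real.log Λ ≤ Real.log Λ ^ 2 := by nlinarith
    have h4 : M * ε ≤ Real.log Λ ^ 2 * ε :=
      mul_le_mul_of_nonneg_right (le_trans hlogΛ hsq) hε.le
    linarith

/-! ## §2 The transport: floor + ceiling + localisation + scaling limits ⇒ `LowerBounds` in the unit `λ*·a` -/

section Lattice

variable (G : Type) [Group G] [TopologicalSpace G] [IsTopologicalGroup G] [CompactSpace G]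
  [MeasurableSpace G] [BorelSpace G] (r : LatticeRep G) (a : ℝ → ℝ)

/-- **`LowerBounds` in a rescaled unit from floor, ceiling, localisation and scaling limits.**  For a
compact `G` (Borel σ-algebra), a lattice representation `r`, an antitone unit map `a → 0⁺` with ratio law
`a(c)/a(c+t) → e^{κt}`, a positive-time `v` with `θv, v` disjointly supported carrying the clause-(i) floor
`ε ≤ Q2_{β,L,aβ}(θv,v)`, the scaling limits `Φ₂`, `Φ₃^f` of `Q2`, `Q3` along the unit, the ceiling
`Q2 ≤ C/log²Λ` on `l ∈ [Λ, 2Λ]` and response localisation `|∂_c Q2 − Q3(f,θv,v)| ≤ η`: some `λ* > 0` has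
`LowerBounds G r (λ*·a)` (both clauses, with the triple `(f, θv, v)`). [folklore] -/
theorem lowerBounds_of_floor_ceiling_localisation
    (v : 𝓢(EuclideanSpace ℝ (Fin 4), ℝ)) (κ ε β₅ Λ₅ C : ℝ) (Φ₂ : ℝ → ℝ)
    (hapos : ∀ β, 0 < a β) (hanti : Antitone a) (hκ : 0 < κ)
    (hratio : ∀ t : ℝ, 0 ≤ t →
      Filter.Tendsto (fun c : ℝ => a c / a (c + t)) Filter.atTop (nhds (Real.exp (κ * t))))
    (hsupp : tsupport v ⊆ {y : EuclideanSpace ℝ (Fin 4) | 0 < y 0})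
    (hdisj : Disjoint (tsupport (thetaTest 4 v)) (tsupport v))
    (hε : 0 < ε)
    (hfloor : ∀ β : ℝ, β₅ ≤ β → ∀ L : ℕ, Λ₅ ≤ a β * L → ε ≤ Q2 G r β L (a β) (thetaTest 4 v) v)
    (hQ2lim : ∀ η : ℝ, 0 < η → ∀ Λ : ℝ, 1 ≤ Λ → ∃ β₆ Λ₆ : ℝ, ∀ β : ℝ, β₆ ≤ β → ∀ L : ℕ,
      Λ₆ ≤ a β * L → ∀ l : ℝ, l ∈ Set.Icc 1 Λ → |Q2 G r β L (l * a β) (thetaTest 4 v) v - Φ₂ l| ≤ η)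
    (hQ3lim : ∀ f : 𝓢(EuclideanSpace ℝ (Fin 4), ℝ), Disjoint (tsupport f) (tsupport v) →
      Disjoint (tsupport f) (tsupport (thetaTest 4 v)) → ∃ Φ₃ : ℝ → ℝ, ∀ η : ℝ, 0 < η →
        ∀ Λ : ℝ, 1 ≤ Λ → ∃ β₆ Λ₆ : ℝ, ∀ β : ℝ, β₆ ≤ β → ∀ L : ℕ, Λ₆ ≤ a β * L →
          ∀ l : ℝ, l ∈ Set.Icc 1 Λ → |Q3 G r β L (l * a β) f (thetaTest 4 v) v - Φ₃ l| ≤ η)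
    (hC : ∀ Λ : ℝ, 2 ≤ Λ → ∃ β₆ Λ₆ : ℝ, ∀ β : ℝ, β₆ ≤ β → ∀ L : ℕ, Λ₆ ≤ a β * L →
      ∀ l : ℝ, l ∈ Set.Icc Λ (2 * Λ) → Q2 G r β L (l * a β) (thetaTest 4 v) v ≤ C / Real.log Λ ^ 2)
    (hloc : ∀ η : ℝ, 0 < η → ∀ Λ : ℝ, 1 ≤ Λ → ∃ f : 𝓢(EuclideanSpace ℝ (Fin 4), ℝ),
      Disjoint (tsupport f) (tsupport v) ∧ Disjoint (tsupport f) (tsupport (thetaTest 4 v)) ∧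
      ∃ β₆ Λ₆ : ℝ, ∀ β : ℝ, β₆ ≤ β → ∀ L : ℕ, Λ₆ ≤ a β * L → ∀ l : ℝ, l ∈ Set.Icc 1 Λ →
        |deriv (fun c : ℝ => Q2 G r c L (l * a β) (thetaTest 4 v) v) β
            - Q3 G r β L (l * a β) f (thetaTest 4 v) v| ≤ η) :
    ∃ lam : ℝ, 0 < lam ∧ LowerBounds G r (fun β => lam * a β) := by
  -- Step 0: the window `Λ`, the coupling range `T₀`
  obtain ⟨Λ, T₀, hΛ2, hT₀1, hexp, hceil⟩ := exists_window ε κ C hε hκ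
  have hT₀ : 0 < T₀ := by linarith
  have hΛpos : 0 < Λ := by linarith
  have h2Λ1 : (1 : ℝ) ≤ 2 * Λ := by linarith
  -- Step 1: the source `f`, the limits, the thresholds
  obtain ⟨β₂, Λ₂, hceil'⟩ := hC Λ hΛ2
  have hη : 0 < ε / (8 * T₀) := by positivity
  obtain ⟨f, hfv, hfθ, β₃, Λ₃, hloc'⟩ := hloc (ε / (8 * T₀)) hη (2 * Λ) h2Λ1
  have hη' : 0 < ε / (16 * T₀) := by positivity
  obtain ⟨β₄, Λ₄, hQ2'⟩ := hQ2lim (ε / (16 * T₀)) hη' (2 * Λ) h2Λ1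
  obtain ⟨Φ₃, hΦ₃⟩ := hQ3lim f hfv hfθ
  obtain ⟨β₆, Λ₆, hQ3'⟩ := hΦ₃ (ε / (16 * T₀)) hη' (2 * Λ) h2Λ1
  -- the ratio law at `t = T₀`: eventually `a c / a (c + T₀) ∈ [Λ, 2Λ]`
  have hrat : ∀ᶠ c in atTop, a c / a (c + T₀) ∈ Set.Icc Λ (2 * Λ) := by
    have ht := hratio T₀ hT₀.le
    rw [hexp] at ht
    exact ht.eventually (Icc_mem_nhds (by linarith) (by linarith))
  obtain ⟨c₁, hc₁⟩ := Filter.eventually_atTop.1 hrat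
  -- Step 2: one large coupling `c₀` and ONE large torus `L₀`
  set c₀ : ℝ := max (max (max β₅ β₂) (max β₃ β₄)) (max β₆ c₁) with hc₀def
  have hc₀β₅ : β₅ ≤ c₀ := le_trans (le_trans (le_max_left _ _) (le_max_left _ _)) (le_max_left _ _)
  have hc₀β₂ : β₂ ≤ c₀ := le_trans (le_trans (le_max_right _ _) (le_max_left _ _)) (le_max_left _ _)
  have hc₀β₃ : β₃ ≤ c₀ := le_trans (le_trans (le_max_left _ _) (le_max_right _ _)) (le_max_left _ _)
  have hc₀β₄ : β₄ ≤ c₀ := le_trans (le_trans (le_max_right _ _) (le_max_right _ _)) (le_max_left _ _)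
  have hc₀β₆ : β₆ ≤ c₀ := le_trans (le_max_left _ _) (le_max_right _ _)
  have hc₀c₁ : c₁ ≤ c₀ := le_trans (le_max_right _ _) (le_max_right _ _)
  have haT : 0 < a (c₀ + T₀) := hapos _
  set Λs : ℝ := max (max (max Λ₅ Λ₂) (max Λ₃ Λ₄)) (max Λ₆ 0) with hΛsdef
  have hΛsΛ₅ : Λ₅ ≤ Λs := le_trans (le_trans (le_max_left _ _) (le_max_left _ _)) (le_max_left _ _)
  have hΛsΛ₂ : Λ₂ ≤ Λs := le_trans (le_trans (le_max_right _ _) (le_max_left _ _)) (le_max_left _ _)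
  have hΛsΛ₃ : Λ₃ ≤ Λs := le_trans (le_trans (le_max_left _ _) (le_max_right _ _)) (le_max_left _ _)
  have hΛsΛ₄ : Λ₄ ≤ Λs := le_trans (le_trans (le_max_right _ _) (le_max_right _ _)) (le_max_left _ _)
  have hΛsΛ₆ : Λ₆ ≤ Λs := le_trans (le_max_left _ _) (le_max_right _ _)
  obtain ⟨L₀, hL₀⟩ := exists_nat_ge (Λs / a (c₀ + T₀))
  have hL₀' : Λs ≤ a (c₀ + T₀) * L₀ := by
    have h := (div_le_iff₀ haT).1 hL₀
    linarith [mul_comm (a (c₀ + T₀)) (L₀ : ℝ)]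
  have hmono : ∀ c : ℝ, c ≤ c₀ + T₀ → a (c₀ + T₀) * L₀ ≤ a c * L₀ := fun c hc =>
    mul_le_mul_of_nonneg_right (hanti hc) (Nat.cast_nonneg L₀)
  -- Step 3: `q(c) := Q2_{c,L₀,a(c₀)}(θv,v)`: floor at `c₀`, ceiling at `c₀ + T₀`, MVT
  have hqdiff : Differentiable ℝ (fun c : ℝ => Q2 G r c L₀ (a c₀) (thetaTest 4 v) v) :=
    Summit.QuantumFields.YangMills.Cruxes.NT.SkewResponse.differentiable_Q2_coupling G r L₀ (a c₀)
      (thetaTest 4 v) v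
  have hq0 : ε ≤ Q2 G r c₀ L₀ (a c₀) (thetaTest 4 v) v :=
    hfloor c₀ hc₀β₅ L₀ (le_trans hΛsΛ₅ (le_trans hL₀' (hmono c₀ (by linarith))))
  have hq1 : Q2 G r (c₀ + T₀) L₀ (a c₀) (thetaTest 4 v) v ≤ ε / 4 := by
    have hl : a c₀ / a (c₀ + T₀) ∈ Set.Icc Λ (2 * Λ) := hc₁ c₀ hc₀c₁
    have h := hceil' (c₀ + T₀) (by linarith) L₀ (le_trans hΛsΛ₂ hL₀') (a c₀ / a (c₀ + T₀)) hl
    rw [div_mul_cancel₀ _ haT.ne'] at h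
    exact h.trans hceil
  obtain ⟨cs, hcs, hqcs, hdq⟩ :=
    exists_level_and_negative_slope (fun c : ℝ => Q2 G r c L₀ (a c₀) (thetaTest 4 v) v) hqdiff hT₀ hε
      hq0 hq1
  have hqcs' : ε / 2 < Q2 G r cs L₀ (a c₀) (thetaTest 4 v) v := hqcs
  -- Step 4: `λ* := a(c₀)/a(c*) ∈ [1, 2Λ]`
  have hacs : 0 < a cs := hapos cs
  have ha_cs_le : a cs ≤ a c₀ := hanti hcs.1.le
  have ha_cs_ge : a (c₀ + T₀) ≤ a cs := hanti hcs.2.le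
  obtain ⟨lam, hlamdef⟩ : ∃ lam : ℝ, lam = a c₀ / a cs := ⟨_, rfl⟩
  have hlam1 : 1 ≤ lam := by
    rw [hlamdef, le_div_iff₀ hacs, one_mul]
    exact ha_cs_le
  have hlam2 : lam ≤ 2 * Λ := by
    calc lam = a c₀ / a cs := hlamdef
      _ ≤ a c₀ / a (c₀ + T₀) := div_le_div_of_nonneg_left (hapos c₀).le haT ha_cs_ge
      _ ≤ 2 * Λ := (hc₁ c₀ hc₀c₁).2
  have hlampos : 0 < lam := by linarith
  have hlam_mem : lam ∈ Set.Icc 1 (2 * Λ) := ⟨hlam1, hlam2⟩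
  have hlam_mul : lam * a cs = a c₀ := by rw [hlamdef]; exact div_mul_cancel₀ _ hacs.ne'
  have hLcs : a (c₀ + T₀) * L₀ ≤ a cs * L₀ := hmono cs hcs.2.le
  -- Step 5: localisation at `(c*, L₀, λ*)`: `Q3_{c*,L₀,a(c₀)}(f,θv,v) ≤ −3ε/(8T₀)`
  have hl3 := hloc' cs (by linarith [hcs.1]) L₀ (le_trans hΛsΛ₃ (le_trans hL₀' hLcs)) lam hlam_mem
  rw [hlam_mul] at hl3
  have hQ3cs : Q3 G r cs L₀ (a c₀) f (thetaTest 4 v) v ≤ -(3 * ε / (8 * T₀)) := by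
    have h := (abs_le.1 hl3).1
    have e : -(ε / (2 * T₀)) + ε / (8 * T₀) = -(3 * ε / (8 * T₀)) := by
      field_simp; ring
    linarith
  -- Step 6: the two limit clauses at `(c*, L₀, λ*)`
  have h2cs := hQ2' cs (by linarith [hcs.1]) L₀ (le_trans hΛsΛ₄ (le_trans hL₀' hLcs)) lam hlam_mem
  rw [hlam_mul] at h2cs
  have hΦ₂ : ε / 2 - ε / (16 * T₀) < Φ₂ lam := by
    have h := (abs_le.1 h2cs).2
    linarith
  have h3cs := hQ3' cs (by linarith [hcs.1]) L₀ (le_trans hΛsΛ₆ (le_trans hL₀' hLcs)) lam hlam_mem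
  rw [hlam_mul] at h3cs
  have hΦ₃ : Φ₃ lam ≤ -(3 * ε / (8 * T₀)) + ε / (16 * T₀) := by
    have h := (abs_le.1 h3cs).1
    linarith
  have hT16 : ε / (16 * T₀) ≤ ε / 16 :=
    div_le_div_of_nonneg_left hε.le (by norm_num) (by linarith)
  -- Step 7: transport to every large `β` and torus, in the unit `λ*·a`
  have hthr : ∀ (Λ' : ℝ) (β : ℝ) (L : ℕ), Λ' ≤ max Λ₄ Λ₆ →
      lam * max Λ₄ Λ₆ ≤ (fun β => lam * a β) β * L → Λ' ≤ a β * L := by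
    intro Λ' β L hΛ' hL
    have h : lam * max Λ₄ Λ₆ ≤ lam * (a β * L) := by simpa [mul_assoc] using hL
    exact le_trans hΛ' (le_of_mul_le_mul_left h hlampos)
  refine ⟨lam, hlampos, ?_, ?_⟩
  · -- clause (i): `Q2 ≥ ε/4` at spacing `λ*·a(β)`
    refine ⟨v, ε / 4, max β₄ β₆, lam * max Λ₄ Λ₆, hsupp, by positivity, ?_⟩
    intro β hβ L hL
    have hb := hQ2' β (le_trans (le_max_left _ _) hβ) L (hthr Λ₄ β L (le_max_left _ _) hL) lam hlam_mem
    have h := (abs_le.1 hb).1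
    show ε / 4 ≤ Q2 G r β L (lam * a β) (thetaTest 4 v) v
    linarith
  · -- clause (ii): `Q3(f, θv, v) ≤ −ε/(4T₀)` at spacing `λ*·a(β)`
    refine ⟨f, thetaTest 4 v, v, ε / (4 * T₀), max β₄ β₆, lam * max Λ₄ Λ₆, hfθ, hdisj, hfv,
      by positivity, ?_⟩
    intro β hβ L hL
    have hb := hQ3' β (le_trans (le_max_right _ _) hβ) L (hthr Λ₆ β L (le_max_right _ _) hL) lam
      hlam_mem
    have h := (abs_le.1 hb).2
    have e : -(3 * ε / (8 * T₀)) + ε / (16 * T₀) + ε / (16 * T₀) = -(ε / (4 * T₀)) := by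
      field_simp; ring
    have hQ3le : Q3 G r β L (lam * a β) f (thetaTest 4 v) v ≤ -(ε / (4 * T₀)) := by linarith
    have hpos : 0 < ε / (4 * T₀) := by positivity
    show ε / (4 * T₀) ≤ |Q3 G r β L (lam * a β) f (thetaTest 4 v) v|
    rw [abs_of_nonpos (by linarith)]
    linarith

end Lattice

/-! ## §3 The item -/

/-- **Item `Assembly` (stmt-QuantumFields-23618) of route `ForcedResponseSkewness`** (route rev 5, «RESTATE-FAR»: the
deciding crux `ResponseLocalisation` is the CONTACT half — a δ-collar bound with `0 < p 0` — and the residual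
`FloorWithScalingLimits` carries the FAR-FIELD bound of the family member):
`FloorWithScalingLimits → RunningCouplingCeiling → ResponseLocalisation → BalabanLadder.NT`.
For every compact simple `G`: the residual gives `(r, a, κ, p, ε)` with `p₀ > 0` and the support-shrinking family; the
member at radius `p₀/2` is a compactly supported floor witness pinning the unit, so the ceiling gives ONE constant `C`
for all normalised sources in `closedBall p (p₀/2)`; `exists_window` fixes `(Λ, T₀)`; with `η = min(1/2, ε/(8T₀))` the
contact crux at tolerance `η/2` on the window `[1, 2Λ]` gives a radius `ρ`; the family member `v` at radius
`min ρ (p₀/2)` carries floor, ceiling, the collar bound (crux) and the far bound (residual) at `η/2` each, which the glue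
`relLocalisation_of_collar_far` (plateau source `f` of `Birth.stub_shell`, exact split `Birth.stub_split`) turns into
the relative localisation `|∂_cQ2 − Q3(f,θv,v)| ≤ η(1 + |∂_cQ2|)`; with the scaling limits,
`lowerBounds_of_floor_ceiling_localisation_rel` gives `λ* > 0` with `LowerBounds G r (λ*·a)`; `λ*·a` is positive and
tends to `0`: this is `NT`'s `∃ (r, a')`.  (The route's three hypotheses stay open; the YM mass gap is not proved
here.) [folklore] -/
theorem assembly_proof : Summit.QuantumFields.YangMills.Theses.ForcedResponseSkewness.Assembly := by
  intro h1 h2 h3 G _ _ _ _ hG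
  letI : MeasurableSpace G := borel G
  haveI : BorelSpace G := ⟨rfl⟩
  obtain ⟨r, a, κ, p, ε, hapos, hlim, hanti, hκ, hratio, hp0, hε, hfam⟩ := h1 G hG
  -- a compactly supported floor witness (family member at radius `p₀/2`) for the ceiling's pinning hypothesis
  have hp2 : 0 < p 0 / 2 := half_pos hp0
  have hp2' : p 0 / 2 < p 0 := half_lt_self hp0
  obtain ⟨v₀, -, hv₀ball, hv₀supp, -, -, ⟨β₅₀, Λ₅₀, hfloor₀⟩, -, -, -⟩ := hfam (p 0 / 2) hp2 hp2'
  have hv₀cpt : HasCompactSupport (v₀ : EuclideanSpace ℝ (Fin 4) → ℝ) :=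
    IsCompact.of_isClosed_subset (isCompact_closedBall p (p 0 / 2)) (isClosed_tsupport _) hv₀ball
  have hpin : ∃ (v₀ : 𝓢(EuclideanSpace ℝ (Fin 4), ℝ)) (ε β₅ Λ₅ : ℝ), HasCompactSupport v₀ ∧
      tsupport v₀ ⊆ {y : EuclideanSpace ℝ (Fin 4) | 0 < y 0} ∧ 0 < ε ∧
      ∀ β : ℝ, β₅ ≤ β → ∀ L : ℕ, Λ₅ ≤ a β * L → ε ≤ Q2 G r β L (a β) (thetaTest 4 v₀) v₀ :=
    ⟨v₀, ε, β₅₀, Λ₅₀, hv₀cpt, hv₀supp, hε, hfloor₀⟩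
  obtain ⟨C, hC⟩ := h2 G hG r a hapos hlim hpin p (p 0 / 2) hp2 hp2'
  -- the window and the coupling range
  obtain ⟨Λ, T₀, hΛ2, hT₀1, hexp, hceil⟩ := exists_window ε κ C hε hκ
  have hT₀ : 0 < T₀ := by linarith
  have h2Λ1 : (1 : ℝ) ≤ 2 * Λ := by linarith
  -- tolerance `η := min (1/2) (ε/(8T₀))`; the contact radius at tolerance `η/2` on the window `[1, 2Λ]`
  set η : ℝ := min (1 / 2 : ℝ) (ε / (8 * T₀)) with hηdef
  have hηpos : 0 < η := lt_min one_half_pos (by positivity)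
  have hη2 : 0 < η / 2 := half_pos hηpos
  obtain ⟨ρ, hρ, hcon⟩ := h3 G hG r a hapos hlim p hp0 ε hε (η / 2) hη2 (2 * Λ) h2Λ1
  -- the test function of the family at radius `min ρ (p₀/2)`
  have hρ' : 0 < min ρ (p 0 / 2) := lt_min hρ hp2
  have hρ'p : min ρ (p 0 / 2) < p 0 := lt_of_le_of_lt (min_le_right _ _) hp2'
  obtain ⟨v, Φ₂, hvball, hvsupp, hvL1, hdisj, ⟨β₅, Λ₅, hfloor⟩, hQ2lim, hQ3lim, hfar⟩ := hfam _ hρ' hρ'p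
  have hvballρ : tsupport (v : EuclideanSpace ℝ (Fin 4) → ℝ) ⊆ Metric.closedBall p ρ :=
    hvball.trans (Metric.closedBall_subset_closedBall (min_le_left _ _))
  have hvballρ₀ : tsupport (v : EuclideanSpace ℝ (Fin 4) → ℝ) ⊆ Metric.closedBall p (p 0 / 2) :=
    hvball.trans (Metric.closedBall_subset_closedBall (min_le_right _ _))
  -- ceiling, collar bound (crux) and far bound (residual) for this `v`; glue to the relative localisation
  have hCv := hC v hvballρ₀ hvL1 Λ hΛ2
  -- rev 6: the crux delivers the SIGNED smooth-collar share with a `[0,1]`-valued cut-off; drop the range clause for the glue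
  obtain ⟨δ, hδ, χ, hχ1, -, hχR, β₆, Λ₆, hcolχ⟩ := hcon v hvballρ hvsupp hvL1 ⟨β₅, Λ₅, hfloor⟩
  have hfarv := hfar (η / 2) hη2 (2 * Λ) h2Λ1
  obtain ⟨f, hfv, hfθ, hlocv⟩ :=
    relLocalisation_of_signedCollar_far G hG r a v η (2 * Λ) hηpos ⟨δ, hδ, χ, hχ1, hχR, β₆, Λ₆, hcolχ⟩ hfarv
  obtain ⟨Φ₃, hΦ₃⟩ := hQ3lim f hfv hfθ
  obtain ⟨lam, hlam, hLB⟩ := lowerBounds_of_floor_ceiling_localisation_rel G r a v f κ ε β₅ Λ₅ C Φ₂ Φ₃ Λ T₀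
    η hapos hanti hratio hvsupp hdisj hε hΛ2 hT₀1 hexp hceil
    (min_le_left _ _) (min_le_right _ _) hfloor hQ2lim hCv hfv hfθ hlocv hΦ₃
  refine ⟨r, fun β => lam * a β, fun β => mul_pos hlam (hapos β), ?_, hLB⟩
  simpa using hlim.const_mul lam

end Summit.QuantumFields.YangMills.Theorems.ForcedResponseSkewness

end
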